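import Literature.MathematicalPhysics.QuantumLattice.Imbrie2016.LLA

/-!
# Imbrie (2016), Assumption LLA: scale covariance of the box Hamiltonian and transfer of LLA to LARGER couplings

CITATION HEADER (lean-in-tree rule 2026-08-18). J. Z. Imbrie, *On many-body localization for quantum spin chains*,
J. Stat. Phys. **163** (2016) 998–1048, doi 10.1007/s10955-016-1508-x, arXiv:1403.7837 [ImbrieJSP2016], eq. (1.1) (model),
p. 1000 (admissible laws), eq. (1.3) = (5.2) (Assumption LLA(ν, C)).

WHAT IS PROVED (a lemma of the audit cell `pub-imbrie`, NOT a statement of the paper). The Hamiltonian (1.1) is jointly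
homogeneous of degree one in (h, J, γ):  `H (c γ) ⟨c h, Γ, c J⟩ = c • H γ ⟨h, Γ, J⟩` (`H_smul`), so the eigenvalue multiset
scales by `c` (`eigs_smul_multiset`) and a gap `< δ` at coupling `γ` becomes a gap `< c δ` at coupling `c γ` (`smallGap_smul`).
If the laws of the fields `h_i` and bonds `J_i` are DILATION-DOMINATED, `(μ.map (c * ·)) ≤ c⁻¹ • μ` for `0 < c ≤ 1`
(true for the uniform law on [-1, 1], `uniformLaw_dilation`; in general: densities non-increasing along rays), then
`P_{γ}(gap < δ) ≤ c^{-(2n+1)} P_{cγ}(gap < cδ)` (`boxMeasure_smallGap_le_dilation`), and consequently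
**LLA(γ; ν, C) ⇒ LLA(γ'; ν, C (γ'/γ)³) for every γ' ≥ γ** (`LLA_mono_coupling`): the assumption at a SMALL coupling is the
STRONGER statement, and LLA at any γ ≤ 1 implies the Hölder minimal-gap bound for the isotropic chain γ' = 1.

STATUS: unconditional algebra + change of variables; says NOTHING about whether LLA holds. LLA for γ > 0 remains an OPEN,
UNPROVED hypothesis of Thm 1.1 (pub-imbrie LLA.md §7). No `sorry`, no new axioms, no new definitions.
-/

noncomputable section
open _root_.MeasureTheory Polynomial Finset
open scoped ENNReal

namespace Literature.MathematicalPhysics.QuantumLattice.Imbrie2016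

variable {n : ℕ}

/-! ## Homogeneity of the Hamiltonian in (h, J, γ) -/

/-- the diagonal energy is linear in (h, J). [cite: ImbrieJSP2016, eq. (1.1)] -/
theorem diagEnergy_smul (c : ℝ) (p : Params n) (σ : Cfg n) :
    diagEnergy (⟨c • p.h, p.Γ, c • p.J⟩ : Params n) σ = c * diagEnergy p σ := by
  unfold diagEnergy
  simp only [Pi.smul_apply, smul_eq_mul, mul_add, Finset.mul_sum]
  congr 1 <;> refine Finset.sum_congr rfl fun i _ => ?_ <;> ring

/-- the transverse part at coupling `c γ` is `c` times the transverse part at coupling `γ` (Γ unchanged). [cite: ImbrieJSP2016, eq. (1.1)] -/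
theorem offDiag_smul (c γ : ℝ) (p : Params n) (σ τ : Cfg n) :
    offDiag (c * γ) (⟨c • p.h, p.Γ, c • p.J⟩ : Params n) σ τ = c * offDiag γ p σ τ := by
  unfold offDiag
  rw [Finset.mul_sum]
  refine Finset.sum_congr rfl fun i _ => ?_
  split_ifs <;> simp [mul_assoc]

/-- **scale covariance**: `H(cγ; c h, Γ, c J) = c · H(γ; h, Γ, J)`. [cite: ImbrieJSP2016, eq. (1.1)] -/
theorem H_smul (c γ : ℝ) (p : Params n) :
    H (c * γ) (⟨c • p.h, p.Γ, c • p.J⟩ : Params n) = c • H γ p := by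
  ext σ τ
  simp only [H, Matrix.add_apply, Matrix.smul_apply, Matrix.of_apply, smul_eq_mul, offDiag_smul,
    Matrix.diagonal_apply, diagEnergy_smul]
  split_ifs <;> ring

/-- characteristic polynomial of a scalar multiple: `χ_{cA}(t) = c^N χ_A(t/c)`. [folklore] -/
theorem charpoly_smul_eq {ι : Type*} [Fintype ι] [DecidableEq ι] (c : ℝ) (hc : c ≠ 0) (A : Matrix ι ι ℝ) :
    (c • A).charpoly = C (c ^ Fintype.card ι) * A.charpoly.comp (C c⁻¹ * X + C 0) := by
  apply Polynomial.funext
  intro t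
  rw [Matrix.eval_charpoly, Polynomial.eval_mul, Polynomial.eval_C, Polynomial.eval_comp, Polynomial.eval_add,
    Polynomial.eval_mul, Polynomial.eval_C, Polynomial.eval_X, Polynomial.eval_C, add_zero, Matrix.eval_charpoly]
  have : Matrix.scalar ι t - c • A = c • (Matrix.scalar ι (c⁻¹ * t) - A) := by
    ext i j
    simp only [Matrix.sub_apply, Matrix.smul_apply, Matrix.scalar_apply, Matrix.diagonal_apply, smul_eq_mul]
    split_ifs
    · field_simp
    · ring
  rw [this, Matrix.det_smul]

/-- the eigenvalue multiset of `H(cγ; ch, Γ, cJ)` is `c` times that of `H(γ; h, Γ, J)`. [cite: ImbrieJSP2016, eq. (1.1)] -/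
theorem eigs_smul_multiset {c : ℝ} (hc : c ≠ 0) (γ : ℝ) (p : Params n) :
    Multiset.map (eigs (c * γ) (⟨c • p.h, p.Γ, c • p.J⟩ : Params n)) univ.val =
      Multiset.map (fun σ => c * eigs γ p σ) univ.val := by
  have h1 := (H_isHermitian (c * γ) (⟨c • p.h, p.Γ, c • p.J⟩ : Params n)).roots_charpoly_eq_eigenvalues
  have h2 := (H_isHermitian γ p).roots_charpoly_eq_eigenvalues
  have h3 : (H (c * γ) (⟨c • p.h, p.Γ, c • p.J⟩ : Params n)).charpoly =
      C (c ^ Fintype.card (Cfg n)) * (H γ p).charpoly.comp (C c⁻¹ * X + C 0) := by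
    rw [H_smul]; exact charpoly_smul_eq c hc _
  have hu : IsUnit (c⁻¹ : ℝ) := isUnit_iff_ne_zero.mpr (inv_ne_zero hc)
  rw [h3, Polynomial.roots_C_mul _ (pow_ne_zero _ hc), Polynomial.roots_comp_C_mul_X_add_C _ _ _ hu, h2] at h1
  have h4 : ∀ f : Cfg n → ℝ, (RCLike.ofReal ∘ f : Cfg n → ℝ) = f := fun f => by funext σ; simp
  rw [h4, h4, Multiset.map_map] at h1
  unfold eigs
  rw [← h1]
  refine Multiset.map_congr rfl fun σ _ => ?_
  simp [Ring.inverse_eq_inv, inv_inv]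

/-- combinatorial core: if the multisets `{f σ}` and `{g σ}` agree and two distinct indices are `δ`-close under `f`,
then two distinct indices are `δ`-close under `g` (a repeated value is repeated in both). [folklore] -/
theorem exists_pair_of_map_eq {ι : Type*} [Fintype ι] [DecidableEq ι] {f g : ι → ℝ}
    (hM : Multiset.map f univ.val = Multiset.map g univ.val) {α β : ι} (hne : α ≠ β) {δ : ℝ}
    (hlt : |f α - f β| < δ) : ∃ σ τ : ι, σ ≠ τ ∧ |g σ - g τ| < δ := by
  have hδ : 0 < δ := lt_of_le_of_lt (abs_nonneg _) hlt
  by_cases heq : f α = f β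
  · set v := f α with hv
    have hcount : 2 ≤ Multiset.count v (Multiset.map g univ.val) := by
      rw [← hM, Multiset.count_map]
      have hsub : ({α, β} : Finset ι) ⊆ univ.filter (fun σ => v = f σ) := by
        intro σ hσ
        simp only [Finset.mem_insert, Finset.mem_singleton] at hσ
        rcases hσ with rfl | rfl
        · simp [Finset.mem_filter, hv]
        · simp only [Finset.mem_filter, Finset.mem_univ, true_and]; exact heq
      have hcard : ({α, β} : Finset ι).card = 2 := Finset.card_pair hne
      calc 2 = ({α, β} : Finset ι).card := hcard.symm
        _ ≤ (univ.filter (fun σ => v = f σ)).card := Finset.card_le_card hsub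
        _ = Multiset.card (Multiset.filter (fun σ => v = f σ) univ.val) := by
            rw [Finset.card_def, Finset.filter_val]
    rw [Multiset.count_map] at hcount
    have hcount' : 1 < (univ.filter (fun σ => v = g σ)).card := by
      rw [Finset.card_def, Finset.filter_val]; omega
    obtain ⟨σ, hσ, τ, hτ, hστ⟩ := Finset.one_lt_card.mp hcount'
    simp only [Finset.mem_filter, Finset.mem_univ, true_and] at hσ hτ
    refine ⟨σ, τ, hστ, ?_⟩
    rw [← hσ, ← hτ, sub_self, abs_zero]; exact hδ
  · have hα : f α ∈ Multiset.map g univ.val := by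
      rw [← hM]; exact Multiset.mem_map_of_mem _ (Finset.mem_univ _)
    have hβ : f β ∈ Multiset.map g univ.val := by
      rw [← hM]; exact Multiset.mem_map_of_mem _ (Finset.mem_univ _)
    obtain ⟨σ, -, hσ⟩ := Multiset.mem_map.mp hα
    obtain ⟨τ, -, hτ⟩ := Multiset.mem_map.mp hβ
    refine ⟨σ, τ, ?_, ?_⟩
    · rintro rfl; exact heq (by rw [← hσ, ← hτ])
    · rw [hσ, hτ]; exact hlt

/-- **gap covariance**: a gap `< δ` at coupling γ is a gap `< cδ` at coupling `cγ` after dilating fields and bonds by `c > 0`.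
[cite: ImbrieJSP2016, eq. (1.3)] -/
theorem smallGap_smul {c γ δ : ℝ} (hc : 0 < c) {p : Params n} (h : SmallGap γ δ p) :
    SmallGap (c * γ) (c * δ) (⟨c • p.h, p.Γ, c • p.J⟩ : Params n) := by
  obtain ⟨α, β, hne, hlt⟩ := h
  have hM := eigs_smul_multiset (ne_of_gt hc) γ p
  have hlt' : |c * eigs γ p α - c * eigs γ p β| < c * δ := by
    rw [← mul_sub, abs_mul, abs_of_pos hc]; exact mul_lt_mul_of_pos_left hlt hc
  obtain ⟨σ, τ, hστ, h⟩ := exists_pair_of_map_eq hM.symm hne hlt'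
  exact ⟨σ, τ, hστ, h⟩

/-! ## Change of variables in the product law -/

/-- product measures on `Fin m → ℝ` are monotone up to constants: `ν_i ≤ K μ_i` for all `i` gives `⊗ν ≤ K^m ⊗μ`. [folklore] -/
theorem pi_le_pow_smul_pi : ∀ (m : ℕ) (μ ν : Fin m → Measure ℝ) [∀ i, SigmaFinite (μ i)] [∀ i, SigmaFinite (ν i)]
    (K : ℝ≥0∞), (∀ i, ν i ≤ K • μ i) → Measure.pi ν ≤ K ^ m • Measure.pi μ
  | 0, μ, ν, _, _, K, _ => by
      rw [Measure.pi_of_empty ν, Measure.pi_of_empty μ, pow_zero, one_smul]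
  | m + 1, μ, ν, _, _, K, h => by
      set e := MeasurableEquiv.piFinSuccAbove (fun _ : Fin (m + 1) => ℝ) 0 with he
      have hν := (measurePreserving_piFinSuccAbove ν 0).map_eq
      have hμ := (measurePreserving_piFinSuccAbove μ 0).map_eq
      have IH := pi_le_pow_smul_pi m (fun j => μ (Fin.succAbove 0 j)) (fun j => ν (Fin.succAbove 0 j)) K
        (fun j => h _)
      calc Measure.pi ν = (Measure.map e (Measure.pi ν)).map e.symm := (MeasurableEquiv.map_symm_map e).symm
        _ = ((ν 0).prod (Measure.pi fun j => ν (Fin.succAbove 0 j))).map e.symm := by rw [hν]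
        _ ≤ ((K • μ 0).prod (K ^ m • Measure.pi fun j => μ (Fin.succAbove 0 j))).map e.symm :=
            Measure.map_mono (Measure.prod_mono (h 0) IH) e.symm.measurable
        _ = K ^ (m + 1) • ((μ 0).prod (Measure.pi fun j => μ (Fin.succAbove 0 j))).map e.symm := by
            rw [Measure.prod_smul_left, Measure.prod_smul_right, Measure.map_smul, Measure.map_smul, smul_smul,
              pow_succ']
        _ = K ^ (m + 1) • Measure.pi μ := by rw [← hμ, MeasurableEquiv.map_symm_map]

/-- **dilation bound for the box law**: if the field and bond laws satisfy `μ.map (c·) ≤ c⁻¹ μ`, then for every event of the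
form {gap < δ}: `P_γ(gap < δ) ≤ c^{-(2n+1)} · P_{cγ}(gap < cδ)` (dilate the n fields and n+1 bonds; Γ untouched).
Audit-cell lemma, not in the paper. [cite: ImbrieJSP2016, eq. (1.3)] -/
theorem boxMeasure_smallGap_le_dilation {L : Laws} {ρ₀ : ℝ} (hL : L.Admissible ρ₀) {c : ℝ} (hc : 0 < c)
    (hh : ∀ i, (L.μh i).map (fun x => c * x) ≤ ENNReal.ofReal c⁻¹ • L.μh i)
    (hJ : ∀ i, (L.μJ i).map (fun x => c * x) ≤ ENNReal.ofReal c⁻¹ • L.μJ i)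
    (γ δ : ℝ) (a : ℤ) (n : ℕ) :
    L.boxMeasure a n {t | SmallGap γ δ (Params.ofTriple t)} ≤
      ENNReal.ofReal c⁻¹ ^ (2 * n + 1) * L.boxMeasure a n {t | SmallGap (c * γ) (c * δ) (Params.ofTriple t)} := by
  haveI : ∀ i, IsProbabilityMeasure (L.μh i) := fun i => (hL i).1.1
  haveI : ∀ i, IsProbabilityMeasure (L.μΓ i) := fun i => (hL i).2.1.1
  haveI : ∀ i, IsProbabilityMeasure (L.μJ i) := fun i => (hL i).2.2.1
  obtain ⟨K, hK⟩ : ∃ K : ℝ≥0∞, K = ENNReal.ofReal c⁻¹ := ⟨_, rfl⟩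
  rw [← hK] at hh hJ ⊢
  -- the three factors of the product law
  obtain ⟨A, hA⟩ : ∃ A : Measure (Fin n → ℝ), A = Measure.pi fun i : Fin n => L.μh (a + i) := ⟨_, rfl⟩
  obtain ⟨B, hB⟩ : ∃ B : Measure (Fin n → ℝ), B = Measure.pi fun i : Fin n => L.μΓ (a + i) := ⟨_, rfl⟩
  obtain ⟨D, hD⟩ : ∃ D : Measure (Fin (n + 1) → ℝ), D = Measure.pi fun b : Fin (n + 1) => L.μJ (a + b - 1) := ⟨_, rfl⟩
  haveI : SigmaFinite A := by rw [hA]; infer_instance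
  haveI : SigmaFinite B := by rw [hB]; infer_instance
  haveI : SigmaFinite D := by rw [hD]; infer_instance
  have hP : L.boxMeasure a n = A.prod (B.prod D) := by rw [Laws.boxMeasure, hA, hB, hD]
  -- the dilation of fields and bonds, coordinatewise
  have hf := measurePreserving_pi (fun i : Fin n => L.μh (a + i)) (fun i : Fin n => (L.μh (a + i)).map (fun x => c * x))
    (f := fun _ x => c * x) (fun i => ⟨measurable_const_mul c, rfl⟩)
  have hg := measurePreserving_pi (fun b : Fin (n + 1) => L.μJ (a + b - 1))
    (fun b : Fin (n + 1) => (L.μJ (a + b - 1)).map (fun x => c * x))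
    (f := fun _ x => c * x) (fun i => ⟨measurable_const_mul c, rfl⟩)
  have hAf : A.map (fun (h : Fin n → ℝ) (i : Fin n) => c * h i) ≤ K ^ n • A := by
    rw [hA, hf.map_eq]
    exact pi_le_pow_smul_pi n _ _ K (fun i => hh _)
  have hDg : D.map (fun (J : Fin (n + 1) → ℝ) (b : Fin (n + 1)) => c * J b) ≤ K ^ (n + 1) • D := by
    rw [hD, hg.map_eq]
    exact pi_le_pow_smul_pi (n + 1) _ _ K (fun i => hJ _)
  obtain ⟨S, hS⟩ : ∃ S : (Fin n → ℝ) × (Fin n → ℝ) × (Fin (n + 1) → ℝ) → (Fin n → ℝ) × (Fin n → ℝ) × (Fin (n + 1) → ℝ),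
      S = Prod.map (fun (h : Fin n → ℝ) (i : Fin n) => c * h i)
        (Prod.map id (fun (J : Fin (n + 1) → ℝ) (b : Fin (n + 1)) => c * J b)) := ⟨_, rfl⟩
  have hSm : Measurable S := by
    rw [hS]; exact hf.measurable.prodMap (measurable_id.prodMap hg.measurable)
  have e1 : (L.boxMeasure a n).map S =
      (A.map (fun (h : Fin n → ℝ) (i : Fin n) => c * h i)).prod
        (B.prod (D.map (fun (J : Fin (n + 1) → ℝ) (b : Fin (n + 1)) => c * J b))) := by
    rw [hP, hS, ← Measure.map_prod_map _ _ hf.measurable (measurable_id.prodMap hg.measurable),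
      ← Measure.map_prod_map _ _ measurable_id hg.measurable, Measure.map_id]
  have hmap : (L.boxMeasure a n).map S ≤ (K ^ n * K ^ (n + 1)) • L.boxMeasure a n := by
    rw [e1, hP]
    calc (A.map (fun (h : Fin n → ℝ) (i : Fin n) => c * h i)).prod
          (B.prod (D.map (fun (J : Fin (n + 1) → ℝ) (b : Fin (n + 1)) => c * J b)))
        ≤ (K ^ n • A).prod (B.prod (K ^ (n + 1) • D)) := Measure.prod_mono hAf (Measure.prod_mono le_rfl hDg)
      _ = (K ^ n * K ^ (n + 1)) • A.prod (B.prod D) := by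
          rw [Measure.prod_smul_left, Measure.prod_smul_right, Measure.prod_smul_right, smul_smul]
  have hsub : {t : (Fin n → ℝ) × (Fin n → ℝ) × (Fin (n + 1) → ℝ) | SmallGap γ δ (Params.ofTriple t)} ⊆
      S ⁻¹' {t | SmallGap (c * γ) (c * δ) (Params.ofTriple t)} := by
    intro t ht
    have hpt : Params.ofTriple (S t) =
        (⟨c • (Params.ofTriple t).h, (Params.ofTriple t).Γ, c • (Params.ofTriple t).J⟩ : Params n) := by
      rw [hS]; rfl
    show SmallGap (c * γ) (c * δ) (Params.ofTriple (S t))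
    rw [hpt]
    exact smallGap_smul hc ht
  have hpow : K ^ n * K ^ (n + 1) = K ^ (2 * n + 1) := by rw [← pow_add]; congr 1; ring
  calc L.boxMeasure a n {t | SmallGap γ δ (Params.ofTriple t)}
      ≤ L.boxMeasure a n (S ⁻¹' {t | SmallGap (c * γ) (c * δ) (Params.ofTriple t)}) := measure_mono hsub
    _ ≤ (L.boxMeasure a n).map S {t | SmallGap (c * γ) (c * δ) (Params.ofTriple t)} := Measure.le_map_apply hSm.aemeasurable _
    _ ≤ ((K ^ n * K ^ (n + 1)) • L.boxMeasure a n) {t | SmallGap (c * γ) (c * δ) (Params.ofTriple t)} := hmap _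
    _ = K ^ (2 * n + 1) * L.boxMeasure a n {t | SmallGap (c * γ) (c * δ) (Params.ofTriple t)} := by
        rw [Measure.smul_apply, smul_eq_mul, hpow]

/-! ## LLA at a small coupling implies LLA at every larger coupling -/

/-- **LLA is monotone in the coupling, up to the constant**: for dilation-dominated field/bond laws,
`LLA(γ; ν, C) ⇒ LLA(γ'; ν, C·(γ'/γ)³)` for all `γ' ≥ γ > 0` (so LLA at small γ is the STRONGER assumption, and implies the
Hölder minimal-gap bound for the isotropic chain γ' = 1 with constant C γ⁻³). Audit-cell theorem, not in the paper.
[cite: ImbrieJSP2016, eq. (1.3)] -/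
theorem LLA_mono_coupling {L : Laws} {ρ₀ : ℝ} (hL : L.Admissible ρ₀) {γ γ' ν C : ℝ} (hγ : 0 < γ) (hγγ' : γ ≤ γ')
    (hν : 0 ≤ ν) (hC : 0 ≤ C)
    (hh : ∀ i, ∀ c : ℝ, 0 < c → c ≤ 1 → (L.μh i).map (fun x => c * x) ≤ ENNReal.ofReal c⁻¹ • L.μh i)
    (hJ : ∀ i, ∀ c : ℝ, 0 < c → c ≤ 1 → (L.μJ i).map (fun x => c * x) ≤ ENNReal.ofReal c⁻¹ • L.μJ i)
    (hLLA : LLA L γ ν C) : LLA L γ' ν (C * (γ' / γ) ^ 3) := by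
  intro a n hn δ hδ
  have hγ' : 0 < γ' := lt_of_lt_of_le hγ hγγ'
  set c := γ / γ' with hc
  have hc0 : 0 < c := div_pos hγ hγ'
  have hc1 : c ≤ 1 := (div_le_one hγ').mpr hγγ'
  have hcγ : c * γ' = γ := by rw [hc]; field_simp
  have hcinv : c⁻¹ = γ' / γ := by rw [hc, inv_div]
  have h1 := boxMeasure_smallGap_le_dilation hL hc0 (fun i => hh i c hc0 hc1) (fun i => hJ i c hc0 hc1) γ' δ a n
  rw [hcγ] at h1
  have h2 := hLLA a n hn (c * δ) (mul_pos hc0 hδ)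
  refine h1.trans ?_
  refine (mul_le_mul_of_nonneg_left h2 zero_le).trans ?_
  rw [hcinv, ← ENNReal.ofReal_pow (by positivity), ← ENNReal.ofReal_mul (by positivity)]
  apply ENNReal.ofReal_le_ofReal
  have hr1 : 1 ≤ γ' / γ := (one_le_div hγ).mpr hγγ'
  have hcd : (c * δ) ^ ν ≤ δ ^ ν := by
    rw [Real.mul_rpow hc0.le hδ.le]
    exact mul_le_of_le_one_left (Real.rpow_nonneg hδ.le ν) (Real.rpow_le_one hc0.le hc1 hν)
  have hpow : (γ' / γ) ^ (2 * n + 1) ≤ (γ' / γ) ^ (3 * n) := pow_le_pow_right₀ hr1 (by omega)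
  calc (γ' / γ) ^ (2 * n + 1) * ((c * δ) ^ ν * C ^ n)
      ≤ (γ' / γ) ^ (3 * n) * (δ ^ ν * C ^ n) := by
        apply mul_le_mul hpow (mul_le_mul_of_nonneg_right hcd (pow_nonneg hC n)) (by positivity) (by positivity)
    _ = δ ^ ν * (C * (γ' / γ) ^ 3) ^ n := by rw [mul_pow, ← pow_mul]; ring

/-- **A2 at coupling γ bounds the gaps at every larger coupling γ'** (in particular for the isotropic chain γ' = 1):
for dilation-dominated field/bond laws, `A2(γ; ν, ε₀)` gives, for every n ≥ 1 and every δ > 0 with `(γ/γ') δ ≤ ε₀ⁿ`,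
`P_{γ'}(gap < δ) ≤ (γ'/γ)^{2n+1} ((γ/γ') δ)^ν` — a Hölder minimal-gap bound at coupling γ' with an n-independent exponent.
Audit-cell theorem, not in the paper. [cite: ImbrieJSP2016, eq. (5.1)] -/
theorem boxMeasure_smallGap_le_of_A2_dilation {L : Laws} {ρ₀ : ℝ} (hL : L.Admissible ρ₀) {γ γ' ν ε₀ : ℝ}
    (hγ : 0 < γ) (hγγ' : γ ≤ γ') (hε₀ : 0 ≤ ε₀)
    (hh : ∀ i, ∀ c : ℝ, 0 < c → c ≤ 1 → (L.μh i).map (fun x => c * x) ≤ ENNReal.ofReal c⁻¹ • L.μh i)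
    (hJ : ∀ i, ∀ c : ℝ, 0 < c → c ≤ 1 → (L.μJ i).map (fun x => c * x) ≤ ENNReal.ofReal c⁻¹ • L.μJ i)
    (hA2 : A2 L γ ν ε₀) (a : ℤ) {n : ℕ} (hn : 0 < n) {δ : ℝ} (hδ : 0 < δ) (hsmall : γ / γ' * δ ≤ ε₀ ^ n) :
    L.boxMeasure a n {t | SmallGap γ' δ (Params.ofTriple t)} ≤
      ENNReal.ofReal ((γ' / γ) ^ (2 * n + 1) * (γ / γ' * δ) ^ ν) := by
  have hγ' : 0 < γ' := lt_of_lt_of_le hγ hγγ'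
  set c := γ / γ' with hc
  have hc0 : 0 < c := div_pos hγ hγ'
  have hc1 : c ≤ 1 := (div_le_one hγ').mpr hγγ'
  have hcγ : c * γ' = γ := by rw [hc]; field_simp
  have hcinv : c⁻¹ = γ' / γ := by rw [hc, inv_div]
  have hn0 : n ≠ 0 := Nat.pos_iff_ne_zero.mp hn
  have hcδ : 0 ≤ c * δ := (mul_pos hc0 hδ).le
  have h1 := boxMeasure_smallGap_le_dilation hL hc0 (fun i => hh i c hc0 hc1) (fun i => hJ i c hc0 hc1) γ' δ a n
  rw [hcγ] at h1
  -- A2 at the scale ε' = (cδ)^{1/n}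
  set ε' : ℝ := (c * δ) ^ ((n : ℝ)⁻¹) with hε'
  have hε'pos : 0 < ε' := Real.rpow_pos_of_pos (mul_pos hc0 hδ) _
  have hε'n : ε' ^ n = c * δ := Real.rpow_inv_natCast_pow hcδ hn0
  have hε'le : ε' ≤ ε₀ := by
    calc ε' ≤ (ε₀ ^ n) ^ ((n : ℝ)⁻¹) := Real.rpow_le_rpow hcδ hsmall (by positivity)
      _ = ε₀ := Real.pow_rpow_inv_natCast hε₀ hn0
  have hε'ν : ε' ^ (ν * n) = (c * δ) ^ ν := by
    rw [hε', ← Real.rpow_mul hcδ]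
    congr 1
    field_simp
  have h2 := hA2 a n hn ε' hε'pos hε'le
  rw [hε'n, hε'ν] at h2
  refine h1.trans ?_
  refine (mul_le_mul_of_nonneg_left h2 zero_le).trans ?_
  rw [hcinv, ← ENNReal.ofReal_pow (by positivity), ← ENNReal.ofReal_mul (by positivity)]

/-- **A2 at coupling γ implies LLA at every larger coupling**, unrestricted in δ, as soon as `(γ/γ')³ ≤ ε₀^ν`
(for γ' = 1: `A2(γ; ν, ε₀)` with `γ³ ≤ ε₀^ν` gives `LLA(1; ν, γ⁻³)`, the Hölder minimal-gap bound for the isotropic chain).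
Audit-cell theorem, not in the paper. [cite: ImbrieJSP2016, eq. (5.1)] -/
theorem LLA_of_A2_dilation {L : Laws} {ρ₀ : ℝ} (hL : L.Admissible ρ₀) {γ γ' ν ε₀ : ℝ}
    (hγ : 0 < γ) (hγγ' : γ ≤ γ') (hν : 0 ≤ ν) (hε₀ : 0 ≤ ε₀) (hbig : (γ / γ') ^ 3 ≤ ε₀ ^ ν)
    (hh : ∀ i, ∀ c : ℝ, 0 < c → c ≤ 1 → (L.μh i).map (fun x => c * x) ≤ ENNReal.ofReal c⁻¹ • L.μh i)
    (hJ : ∀ i, ∀ c : ℝ, 0 < c → c ≤ 1 → (L.μJ i).map (fun x => c * x) ≤ ENNReal.ofReal c⁻¹ • L.μJ i)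
    (hA2 : A2 L γ ν ε₀) : LLA L γ' ν ((γ' / γ) ^ 3) := by
  haveI : ∀ i, IsProbabilityMeasure (L.μh i) := fun i => (hL i).1.1
  haveI : ∀ i, IsProbabilityMeasure (L.μΓ i) := fun i => (hL i).2.1.1
  haveI : ∀ i, IsProbabilityMeasure (L.μJ i) := fun i => (hL i).2.2.1
  intro a n hn δ hδ
  have hγ' : 0 < γ' := lt_of_lt_of_le hγ hγγ'
  have hc0 : 0 < γ / γ' := div_pos hγ hγ'
  have hc1 : γ / γ' ≤ 1 := (div_le_one hγ').mpr hγγ'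
  have hr1 : 1 ≤ γ' / γ := (one_le_div hγ).mpr hγγ'
  have hrc : γ' / γ = (γ / γ')⁻¹ := by rw [inv_div]
  by_cases hsmall : γ / γ' * δ ≤ ε₀ ^ n
  · refine (boxMeasure_smallGap_le_of_A2_dilation hL hγ hγγ' hε₀ hh hJ hA2 a hn hδ hsmall).trans ?_
    apply ENNReal.ofReal_le_ofReal
    have hcd : (γ / γ' * δ) ^ ν ≤ δ ^ ν := by
      rw [Real.mul_rpow hc0.le hδ.le]
      exact mul_le_of_le_one_left (Real.rpow_nonneg hδ.le ν) (Real.rpow_le_one hc0.le hc1 hν)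
    have hpow : (γ' / γ) ^ (2 * n + 1) ≤ (γ' / γ) ^ (3 * n) := pow_le_pow_right₀ hr1 (by omega)
    calc (γ' / γ) ^ (2 * n + 1) * (γ / γ' * δ) ^ ν ≤ (γ' / γ) ^ (3 * n) * δ ^ ν :=
          mul_le_mul hpow hcd (by positivity) (by positivity)
      _ = δ ^ ν * ((γ' / γ) ^ 3) ^ n := by rw [← pow_mul]; ring
  · -- large δ: the bound is ≥ 1 and the event has probability ≤ 1
    rw [not_le] at hsmall
    have hP : L.boxMeasure a n {t | SmallGap γ' δ (Params.ofTriple t)} ≤ 1 := by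
      unfold Laws.boxMeasure; exact prob_le_one
    refine hP.trans ?_
    rw [← ENNReal.ofReal_one]
    apply ENNReal.ofReal_le_ofReal
    -- 1 ≤ δ^ν (γ'/γ)^{3n}: from ε₀^n < (γ/γ') δ and (γ/γ')^3 ≤ ε₀^ν
    have hε₀n : 0 ≤ ε₀ ^ n := pow_nonneg hε₀ n
    have hδlow : ε₀ ^ n < γ / γ' * δ := hsmall
    -- (ε₀^n)^ν ≤ ((γ/γ') δ)^ν = (γ/γ')^ν δ^ν
    have hA : (ε₀ ^ ν) ^ n ≤ (γ / γ') ^ ν * δ ^ ν := by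
      have : (ε₀ ^ ν) ^ n = (ε₀ ^ n) ^ ν := by
        rw [← Real.rpow_natCast, ← Real.rpow_natCast, ← Real.rpow_mul hε₀, ← Real.rpow_mul hε₀, mul_comm]
      rw [this, ← Real.mul_rpow hc0.le hδ.le]
      exact Real.rpow_le_rpow hε₀n hδlow.le hν
    -- ((γ/γ')^3)^n ≤ (ε₀^ν)^n
    have hB : ((γ / γ') ^ 3) ^ n ≤ (ε₀ ^ ν) ^ n := pow_le_pow_left₀ (by positivity) hbig n
    -- (γ/γ')^ν ≤ 1
    have hC : (γ / γ') ^ ν ≤ 1 := Real.rpow_le_one hc0.le hc1 hν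
    have hD : ((γ / γ') ^ 3) ^ n * ((γ' / γ) ^ 3) ^ n = 1 := by
      rw [← mul_pow, ← mul_pow, hrc, mul_inv_cancel₀ (ne_of_gt hc0), one_pow, one_pow]
    have hδν : 0 ≤ δ ^ ν := Real.rpow_nonneg hδ.le ν
    calc (1 : ℝ) = ((γ / γ') ^ 3) ^ n * ((γ' / γ) ^ 3) ^ n := hD.symm
      _ ≤ ((γ / γ') ^ ν * δ ^ ν) * ((γ' / γ) ^ 3) ^ n :=
          mul_le_mul_of_nonneg_right (hB.trans hA) (by positivity)
      _ ≤ (1 * δ ^ ν) * ((γ' / γ) ^ 3) ^ n := by gcongr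
      _ = δ ^ ν * ((γ' / γ) ^ 3) ^ n := by rw [one_mul]

/-- the uniform law on [-1, 1] (density 1/2) is dilation-dominated: `U.map (c·) ≤ c⁻¹ U` for `0 < c ≤ 1`
(so `LLA_mono_coupling` applies to Imbrie's basic example of uniform disorder). [cite: ImbrieJSP2016, p. 1000] -/
theorem uniformLaw_dilation {c : ℝ} (hc0 : 0 < c) (hc1 : c ≤ 1) :
    ((ENNReal.ofReal 2⁻¹ • volume.restrict (Set.Icc (-1 : ℝ) 1)).map (fun x => c * x)) ≤
      ENNReal.ofReal c⁻¹ • (ENNReal.ofReal 2⁻¹ • volume.restrict (Set.Icc (-1 : ℝ) 1)) := by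
  have hpre : (fun x : ℝ => c * x) ⁻¹' Set.Icc (-c) c = Set.Icc (-1 : ℝ) 1 := by
    rw [Set.preimage_const_mul_Icc₀ _ _ hc0, neg_div, div_self (ne_of_gt hc0)]
  have hmap : (volume.restrict (Set.Icc (-1 : ℝ) 1)).map (fun x => c * x) =
      ENNReal.ofReal c⁻¹ • volume.restrict (Set.Icc (-c) c) := by
    rw [← hpre, ← Measure.restrict_map (measurable_const_mul c) measurableSet_Icc, Real.map_volume_mul_left (ne_of_gt hc0),
      Measure.restrict_smul, abs_of_pos (inv_pos.mpr hc0)]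
  rw [Measure.map_smul, hmap, Measure.le_iff']
  intro s
  have key := Measure.le_iff'.1
    (Measure.restrict_mono (Set.Icc_subset_Icc (by linarith) hc1) (le_refl (volume : Measure ℝ))) s
  simp only [Measure.smul_apply, smul_eq_mul]
  calc ENNReal.ofReal 2⁻¹ * (ENNReal.ofReal c⁻¹ * volume.restrict (Set.Icc (-c) c) s)
      = ENNReal.ofReal c⁻¹ * (ENNReal.ofReal 2⁻¹ * volume.restrict (Set.Icc (-c) c) s) := by ring
    _ ≤ ENNReal.ofReal c⁻¹ * (ENNReal.ofReal 2⁻¹ * volume.restrict (Set.Icc (-1 : ℝ) 1) s) := by gcongr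

end Literature.MathematicalPhysics.QuantumLattice.Imbrie2016
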